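import Summits.AtomisticToContinuum.Crystallization.Theorems.ChartedZeroExcessLayeredLatticeLiouvilleZZZYRCZO

/-!
# Charted zero-excess layered-lattice Liouville — ZZZYRCZP: the ANGLE COMPARISON lemma of a slab box (item 5b), letter sequences

Cell `decomp-a2c`, lens 2, generation 100.  The near θ⁰ reader (ZZZYRCX `ThetaReaderNear`, proved in ZZZYRCY) factors the box scalars
out of the word-indexed tables through TWO comparisons a box file owes: the LENGTH comparison `IdealLengthCmpF ℓ λ μ` (from the slab box:
ZZZYRCZO, periodic case ZZZYRCZM) and the ANGLE comparison `IdealAngleCmpF ℓ K η` — `sin²(e_x, e_q) ≤ K·sin²₀(x, q) + η` on pairs of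
nonzero ideal length.  This file proves the second for an ARBITRARY letter sequence `ℓ : ℤ → ℤ` (r1864 «APERIODIC-COVER»: the atlas is
indexed by letter windows, not periodic words) from the slab box `SlabBoxF ℓ aLo aHi s τ hLo hHi L w`, with the CLOSED FORMS (any dial
`β > 0`, `λ` the length floor)

  `K = (1+β)·((1+s)·aHi/λ)²`,   `η = 6·(1+β⁻¹)·(aHi/λ)²·(τ² + (hHi − hLo)²/4)`,

and derives the periodic-word statements (`IdealAngleCmp wd`, `SlabBoxW wd`) as the instance `ℓ := regW wd` through the `rfl` bridges
of ZZZYRCZO §1–§2.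

## The argument (variational, no cross products)

* `sinSq_le_witness`: `sin²(e, e') = 1 − ⟪e,e'⟫²/(‖e‖²‖e'‖²) ≤ ‖e' − t•e‖²/‖e'‖²` for EVERY real `t` (the minimum over `t` is the
  left side).  We test with the IDEAL minimiser `t⋆ = d18/(2·n9)` (`= ⟨I_x, I_q⟩/‖I_x‖²` for the ideal vectors, `9‖I‖² = n9`,
  `18⟨I, I'⟩ = d18`).
* the slab-box decomposition `e = L v + R + H•n` (ZZZYRCZO `bondVec_decomp_of_stepsF`: in-plane ideal part, slip sum, height sum along
  the unit normal) is linear in the pair, so `e' − t⋆e = L(v' − t⋆v) + (R' − t⋆R) + (H' − t⋆H)•n`; Pythagoras across `n`, the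
  conformal bound `‖L u‖ ≤ (1+s)a‖u‖`, the slip bound `‖R‖ ≤ τ a d` and the height pinning `|H − a h̄ d| ≤ a(Δh/2)d`
  (`h̄ = (hLo+hHi)/2`, `Δh = hHi − hLo`) give `‖e' − t⋆e‖² ≤ (1+β)a²(1+s)²‖I' − t⋆I‖² + (1+β⁻¹)a²(τ² + Δh²/4)·P²` with
  `P = d' + |t⋆|d ≤ √(⅔n9')` (Young `(p+q)² ≤ (1+β)p² + (1+β⁻¹)q²`; the height/in-plane ratio needs the mild check
  `3(hLo+hHi)² ≤ 8(1+s)²`);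
* the WITNESS IDENTITY `9‖I' − t⋆I‖² = n9' − d18²/(4n9) = n9'·sin²₀` and the length floor `9‖e'‖² ≥ λ²n9'` finish it.

Main results: `angleCmpF_pair_of_steps` (both pairs upward), the swap symmetries of `sinSqPair` / `sinSq0F`, `sinSq0F_nonneg`
(Cauchy–Schwarz `d18² ≤ 4·n9·n9'`), ★ `idealAngleCmpF_of_slabBoxF : SlabBoxF ℓ … → IdealLengthCmpF ℓ λ μ … → (sign conditions) →
IdealAngleCmpF ℓ K η (gen₁ L) (gen₂ L) w`, and §4 the periodic instances `sinSq0_nonneg`, `idealAngleCmp_mono`,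
★ `idealAngleCmp_of_slabBox`.  On the ATLAS-D-56 cell of record (`s = 1/50`, `τ = 0.0175`, `hLo = 0.7536`, `hHi = 0.7798`,
`aHi = 0.8701`, `λ = 0.77424`, `β = 1`): `K ≤ 2.63`, `η ≤ 7.3e-3` (census costs `η` against the class maximum
`max_k θ⁰_R(k) ≈ 2e-3`, not the site sum, and picks `β` per cell).
-/

namespace Summit.AtomisticToContinuum.Crystallization.Theorems.ChartedZeroExcessLayeredLatticeLiouville

open scoped BigOperators RealInnerProductSpace
open Literature.MathematicalPhysics.StatisticalMechanics (triangularVec₁ triangularVec₂)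
open Summit.AtomisticToContinuum.Crystallization.Theorems.ChartedPlanarOrderRigidityDoor (E3)

/-! ### §1 pure-real and pure-geometric cores -/

/-- the VARIATIONAL BOUND for `sin²`: `1 − ⟪e,e'⟫²/(‖e‖²‖e'‖²) ≤ ‖e' − t•e‖²/‖e'‖²` for every `t` (`e' ≠ 0`; equality at
`t = ⟪e,e'⟫/‖e‖²`). [g100] -/
theorem sinSq_le_witness (e e' : E3) (he' : e' ≠ 0) (t : ℝ) :
    1 - ⟪e, e'⟫ ^ 2 / (‖e‖ ^ 2 * ‖e'‖ ^ 2) ≤ ‖e' - t • e‖ ^ 2 / ‖e'‖ ^ 2 := by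
  have he'2 : 0 < ‖e'‖ ^ 2 := by positivity
  have hexp : ‖e' - t • e‖ ^ 2 = ‖e'‖ ^ 2 - 2 * t * ⟪e, e'⟫ + t ^ 2 * ‖e‖ ^ 2 := by
    rw [norm_sub_sq_real, real_inner_smul_right, norm_smul, mul_pow, Real.norm_eq_abs, sq_abs, real_inner_comm]; ring
  by_cases he : e = 0
  · subst he
    simp only [inner_zero_left, norm_zero, smul_zero, sub_zero]
    rw [div_self he'2.ne']
    simp
  have he2 : 0 < ‖e‖ ^ 2 := by positivity
  have key : ‖e'‖ ^ 2 - ⟪e, e'⟫ ^ 2 / ‖e‖ ^ 2 ≤ ‖e' - t • e‖ ^ 2 := by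
    rw [hexp]
    have h1 : 0 ≤ (t * ‖e‖ ^ 2 - ⟪e, e'⟫) ^ 2 / ‖e‖ ^ 2 := by positivity
    have h2 : (t * ‖e‖ ^ 2 - ⟪e, e'⟫) ^ 2 / ‖e‖ ^ 2 = t ^ 2 * ‖e‖ ^ 2 - 2 * t * ⟪e, e'⟫ + ⟪e, e'⟫ ^ 2 / ‖e‖ ^ 2 := by
      field_simp
      ring
    linarith [h1, h2]
  have hre : 1 - ⟪e, e'⟫ ^ 2 / (‖e‖ ^ 2 * ‖e'‖ ^ 2) = (‖e'‖ ^ 2 - ⟪e, e'⟫ ^ 2 / ‖e‖ ^ 2) / ‖e'‖ ^ 2 := by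
    field_simp
  rw [hre]
  exact div_le_div_of_nonneg_right key he'2.le

/-- THE ANGLE CORE (pure reals): in-plane `U ≤ (a+sa)X + τaP`, normal `|N| ≤ |a h̄ Y| + (aΔh/2)P`, `P² ≤ ⅔ n9'`,
`9X² + 6Y² = n9'·s0`, `3(hLo+hHi)² ≤ 8(1+s)²` ⇒ `U² + N² ≤ (1+β)a²(1+s)²·n9'·s0/9 + (1+β⁻¹)a²(τ² + Δh²/4)·⅔n9'`. [g100] -/
theorem angle_core {a s τ hLo hHi β X Y P U N n9' s0 : ℝ} (hβ : 0 < β) (hP : 0 ≤ P) (hU0 : 0 ≤ U)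
    (hU : U ≤ (a + s * a) * X + τ * a * P) (hN : |N| ≤ |a * ((hLo + hHi) / 2) * Y| + a * ((hHi - hLo) / 2) * P)
    (hP2 : P ^ 2 ≤ 2 / 3 * n9') (hid : 9 * X ^ 2 + 6 * Y ^ 2 = n9' * s0) (hhb : 3 * (hLo + hHi) ^ 2 ≤ 8 * (1 + s) ^ 2)
    (ha : 0 ≤ a) (hΔ : hLo ≤ hHi) :
    U ^ 2 + N ^ 2 ≤ (1 + β) * a ^ 2 * (1 + s) ^ 2 * (n9' * s0) / 9 +
      (1 + β⁻¹) * a ^ 2 * (τ ^ 2 + (hHi - hLo) ^ 2 / 4) * (2 / 3 * n9') := by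
  -- Young's inequality with the dial `β` (cf. `Literature.Analysis.Calculus.add_sq_le_weighted`, not imported here)
  have young : ∀ p q : ℝ, (p + q) ^ 2 ≤ (1 + β) * p ^ 2 + (1 + β⁻¹) * q ^ 2 := fun p q => by
    have h : (1 + β) * p ^ 2 + (1 + β⁻¹) * q ^ 2 - (p + q) ^ 2 = (β * p - q) ^ 2 / β := by
      field_simp
      ring
    have h0 : 0 ≤ (β * p - q) ^ 2 / β := by positivity
    linarith [h, h0]
  have hβ' : 0 < β⁻¹ := inv_pos.2 hβ
  have hU2 : U ^ 2 ≤ (1 + β) * ((a + s * a) * X) ^ 2 + (1 + β⁻¹) * (τ * a * P) ^ 2 :=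
    (pow_le_pow_left₀ hU0 hU 2).trans (young _ _)
  have hq0 : 0 ≤ a * ((hHi - hLo) / 2) * P := by
    have : 0 ≤ (hHi - hLo) / 2 := by linarith
    positivity
  have hN2 : N ^ 2 ≤ (1 + β) * (a * ((hLo + hHi) / 2) * Y) ^ 2 + (1 + β⁻¹) * (a * ((hHi - hLo) / 2) * P) ^ 2 := by
    have h1 : N ^ 2 ≤ (|a * ((hLo + hHi) / 2) * Y| + a * ((hHi - hLo) / 2) * P) ^ 2 := by
      rw [← sq_abs N]; exact pow_le_pow_left₀ (abs_nonneg N) hN 2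
    have h2 := young |a * ((hLo + hHi) / 2) * Y| (a * ((hHi - hLo) / 2) * P)
    rw [sq_abs] at h2
    exact h1.trans h2
  have hY : (a * ((hLo + hHi) / 2) * Y) ^ 2 ≤ a ^ 2 * (1 + s) ^ 2 * (2 / 3 * Y ^ 2) := by
    have h1 : (a * ((hLo + hHi) / 2) * Y) ^ 2 = a ^ 2 * Y ^ 2 * ((hLo + hHi) ^ 2 / 4) := by ring
    have h2 : a ^ 2 * (1 + s) ^ 2 * (2 / 3 * Y ^ 2) = a ^ 2 * Y ^ 2 * (2 / 3 * (1 + s) ^ 2) := by ring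
    rw [h1, h2]
    exact mul_le_mul_of_nonneg_left (by linarith) (by positivity)
  have hmain : U ^ 2 + N ^ 2 ≤ (1 + β) * (a ^ 2 * (1 + s) ^ 2 * (X ^ 2 + 2 / 3 * Y ^ 2)) +
      (1 + β⁻¹) * (a ^ 2 * (τ ^ 2 + (hHi - hLo) ^ 2 / 4) * P ^ 2) := by
    have e1 : (1 + β) * (a ^ 2 * (1 + s) ^ 2 * (X ^ 2 + 2 / 3 * Y ^ 2)) =
        (1 + β) * ((a + s * a) * X) ^ 2 + (1 + β) * (a ^ 2 * (1 + s) ^ 2 * (2 / 3 * Y ^ 2)) := by ring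
    have e2 : (1 + β⁻¹) * (a ^ 2 * (τ ^ 2 + (hHi - hLo) ^ 2 / 4) * P ^ 2) =
        (1 + β⁻¹) * (τ * a * P) ^ 2 + (1 + β⁻¹) * (a * ((hHi - hLo) / 2) * P) ^ 2 := by ring
    rw [e1, e2]
    have h3 : (1 + β) * (a * ((hLo + hHi) / 2) * Y) ^ 2 ≤ (1 + β) * (a ^ 2 * (1 + s) ^ 2 * (2 / 3 * Y ^ 2)) :=
      mul_le_mul_of_nonneg_left hY (by linarith)
    linarith [hU2, hN2, h3]
  have hXY : X ^ 2 + 2 / 3 * Y ^ 2 = n9' * s0 / 9 := by linarith [hid]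
  rw [hXY] at hmain
  have hP3 : (1 + β⁻¹) * (a ^ 2 * (τ ^ 2 + (hHi - hLo) ^ 2 / 4) * P ^ 2) ≤
      (1 + β⁻¹) * a ^ 2 * (τ ^ 2 + (hHi - hLo) ^ 2 / 4) * (2 / 3 * n9') := by
    have h0 : 0 ≤ (1 + β⁻¹) * a ^ 2 * (τ ^ 2 + (hHi - hLo) ^ 2 / 4) := by positivity
    have := mul_le_mul_of_nonneg_left hP2 h0
    linarith [this]
  linarith [hmain, hP3]

/-- THE RATIO STEP (pure reals): `S ≤ W/E`, `W ≤ (1+β)a²(1+s)²n9's0/9 + (1+β⁻¹)a²c·⅔n9'`, `λ²n9' ≤ 9E`, `0 < λ`, `0 < n9'`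
⇒ `S ≤ (1+β)((1+s)a/λ)²·s0 + 6(1+β⁻¹)(a/λ)²·c`. [g100] -/
theorem angle_ratio {a s β lam c n9' s0 W E S : ℝ} (hβ : 0 < β) (hlam : 0 < lam) (hn : 0 < n9') (hW0 : 0 ≤ W) (hSW : S ≤ W / E)
    (hW : W ≤ (1 + β) * a ^ 2 * (1 + s) ^ 2 * (n9' * s0) / 9 + (1 + β⁻¹) * a ^ 2 * c * (2 / 3 * n9'))
    (hE : lam ^ 2 * n9' ≤ 9 * E) :
    S ≤ (1 + β) * ((1 + s) * a / lam) ^ 2 * s0 + 6 * (1 + β⁻¹) * (a / lam) ^ 2 * c := by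
  have hβ' : 0 < β⁻¹ := inv_pos.2 hβ
  have hE0 : 0 < lam ^ 2 * n9' / 9 := by positivity
  have hEpos : 0 < E := by linarith
  have h1 : W / E ≤ W / (lam ^ 2 * n9' / 9) := div_le_div_of_nonneg_left hW0 hE0 (by linarith)
  have h2 : W / (lam ^ 2 * n9' / 9) ≤ ((1 + β) * a ^ 2 * (1 + s) ^ 2 * (n9' * s0) / 9 +
      (1 + β⁻¹) * a ^ 2 * c * (2 / 3 * n9')) / (lam ^ 2 * n9' / 9) := div_le_div_of_nonneg_right hW hE0.le
  have h3 : ((1 + β) * a ^ 2 * (1 + s) ^ 2 * (n9' * s0) / 9 + (1 + β⁻¹) * a ^ 2 * c * (2 / 3 * n9')) / (lam ^ 2 * n9' / 9) =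
      (1 + β) * ((1 + s) * a / lam) ^ 2 * s0 + 6 * (1 + β⁻¹) * (a / lam) ^ 2 * c := by
    field_simp
    ring
  linarith [hSW, h1, h2, h3.le, h3.ge]

/-! ### §2 the ideal facts and the pair lemma -/

/-- `qhex ≥ 0`: `A² + AB + B² = (A + B/2)² + ¾B²`. [g100] -/
theorem qhex_nonneg (A B : ℝ) : 0 ≤ A * A + A * B + B * B := by
  nlinarith [sq_nonneg (A + B / 2), sq_nonneg B]

/-- THE IDEAL FACTS at the witness `t = d18/(2n9)` (pure reals, `A = 3c₀, B = 3c₁, …`): the witness identity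
`9X² + 6(m' − tm)² = n9'·s0`, the bound `(m' + |t|m)² ≤ ⅔n9'` and `0 ≤ s0`. [g100] -/
theorem angle_ideal_facts {c₀ c₁ c₀' c₁' m m' t X n9 n9' d18 s0 : ℝ} (hn9p : 0 < n9) (hn9p' : 0 < n9')
    (hn9 : n9 = (3 * c₀) * (3 * c₀) + (3 * c₀) * (3 * c₁) + (3 * c₁) * (3 * c₁) + 6 * m ^ 2)
    (hn9' : n9' = (3 * c₀') * (3 * c₀') + (3 * c₀') * (3 * c₁') + (3 * c₁') * (3 * c₁') + 6 * m' ^ 2)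
    (hd18 : d18 = 2 * (3 * c₀) * (3 * c₀') + 2 * (3 * c₁) * (3 * c₁') + (3 * c₀) * (3 * c₁') + (3 * c₀') * (3 * c₁) +
      12 * m * m')
    (ht : t = d18 / (2 * n9)) (hs0 : s0 = 1 - d18 ^ 2 / (4 * n9 * n9'))
    (hX : X ^ 2 = (c₀' - t * c₀) ^ 2 + (c₀' - t * c₀) * (c₁' - t * c₁) + (c₁' - t * c₁) ^ 2) :
    9 * X ^ 2 + 6 * (m' - t * m) ^ 2 = n9' * s0 ∧ (m' + |t| * m) ^ 2 ≤ 2 / 3 * n9' ∧ 0 ≤ s0 := by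
  have hqq : 0 ≤ (3 * c₀) * (3 * c₀) + (3 * c₀) * (3 * c₁) + (3 * c₁) * (3 * c₁) := qhex_nonneg _ _
  have hqq' : 0 ≤ (3 * c₀') * (3 * c₀') + (3 * c₀') * (3 * c₁') + (3 * c₁') * (3 * c₁') := qhex_nonneg _ _
  have hcs : d18 ^ 2 ≤ 4 * n9 * n9' := by rw [hd18, hn9, hn9']; exact ideal_cs _ _ _ _ _ _
  refine ⟨?_, ?_, ?_⟩
  · have h1 : 9 * X ^ 2 + 6 * (m' - t * m) ^ 2 = n9' - t * d18 + t ^ 2 * n9 := by rw [hX, hn9, hn9', hd18]; ring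
    rw [h1, hs0, ht]
    field_simp
    ring
  · have hta : (|t| * m) ^ 2 = (t * m) ^ 2 := by rw [mul_pow, sq_abs, mul_pow]
    have e1 : (m' + |t| * m) ^ 2 + (m' - |t| * m) ^ 2 = 2 * m' ^ 2 + 2 * (|t| * m) ^ 2 := by ring
    have h1 : (m' + |t| * m) ^ 2 ≤ 2 * m' ^ 2 + 2 * (t * m) ^ 2 := by linarith [sq_nonneg (m' - |t| * m), e1, hta]
    have h2 : 6 * m' ^ 2 ≤ n9' := by rw [hn9']; linarith [hqq']
    have e2 : t ^ 2 * ((3 * c₀) * (3 * c₀) + (3 * c₀) * (3 * c₁) + (3 * c₁) * (3 * c₁) + 6 * m ^ 2) =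
        t ^ 2 * ((3 * c₀) * (3 * c₀) + (3 * c₀) * (3 * c₁) + (3 * c₁) * (3 * c₁)) + 6 * (t * m) ^ 2 := by ring
    have h4 : 6 * (t * m) ^ 2 ≤ t ^ 2 * n9 := by rw [hn9]; linarith [mul_nonneg (sq_nonneg t) hqq, e2]
    have h5 : t ^ 2 * n9 = d18 ^ 2 / (4 * n9) := by rw [ht]; field_simp; ring
    have h6 : d18 ^ 2 / (4 * n9) ≤ n9' := by rw [div_le_iff₀ (by positivity)]; linarith [hcs]
    linarith [h1, h2, h4, h5, h6]
  · rw [hs0, sub_nonneg, div_le_one (by positivity)]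
    exact hcs

/-- THE ANGLE COMPARISON FOR TWO UPWARD PAIRS of a word in the slab box (data `a, n, r, h` of `SlabBoxW` explicit; `λ` = any length
floor at `q`): `sin²(e_x, e_q) ≤ (1+β)((1+s)a/λ)²·sin²₀ + 6(1+β⁻¹)(a/λ)²(τ² + Δh²/4)`. [g100] -/
theorem angleCmpF_pair_of_steps {ℓ : ℤ → ℤ} {a s τ hLo hHi lam β : ℝ} {L : E3 ≃L[ℝ] E3} {w r : ℤ → E3} {h : ℤ → ℝ} {n : E3}
    (ha : 0 ≤ a) (hΔ : hLo ≤ hHi) (hhb : 3 * (hLo + hHi) ^ 2 ≤ 8 * (1 + s) ^ 2) (hlam : 0 < lam) (hβ : 0 < β)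
    (hconf : IsConfChart a s (L : E3 →L[ℝ] E3)) (hn : ‖n‖ = 1) (hg₁ : ⟪gen₁ L, n⟫ = 0) (hg₂ : ⟪gen₂ L, n⟫ = 0)
    (hr : ∀ m, ‖r m‖ ≤ τ * a) (hh : ∀ m, hLo * a ≤ h m ∧ h m ≤ hHi * a) (hrn : ∀ m, ⟪r m, n⟫ = 0)
    (hstep : ∀ m : ℤ, w (m + 1) - w m = (((ℓ (m + 1) : ℝ) - ℓ m) / 3) • (gen₁ L + gen₂ L) + r m + h m • n)
    (x q : (Cell 2 × ℤ) × (Cell 2 × ℤ)) (hx : 0 < n9F ℓ x) (hq : 0 < n9F ℓ q) (hxle : x.1.2 ≤ x.2.2) (hqle : q.1.2 ≤ q.2.2)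
    (hlen : lam ^ 2 * (n9F ℓ q : ℝ) ≤ 9 * ‖bondVec (gen₁ L) (gen₂ L) w q‖ ^ 2) :
    sinSqPair (gen₁ L) (gen₂ L) w x q ≤ (1 + β) * ((1 + s) * a / lam) ^ 2 * sinSq0F ℓ x q +
      6 * (1 + β⁻¹) * (a / lam) ^ 2 * (τ ^ 2 + (hHi - hLo) ^ 2 / 4) := by
  -- upward steps `d, d'` and the slip / height sums
  obtain ⟨d, hdℤ⟩ : ∃ d : ℕ, ((d : ℕ) : ℤ) = x.2.2 - x.1.2 := ⟨_, Int.toNat_of_nonneg (sub_nonneg.2 hxle)⟩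
  obtain ⟨d', hdℤ'⟩ : ∃ d' : ℕ, ((d' : ℕ) : ℤ) = q.2.2 - q.1.2 := ⟨_, Int.toNat_of_nonneg (sub_nonneg.2 hqle)⟩
  have hd : x.2.2 = x.1.2 + d := by rw [hdℤ]; ring
  have hd' : q.2.2 = q.1.2 + d' := by rw [hdℤ']; ring
  have hdℝ : ((d : ℕ) : ℝ) = (x.2.2 : ℝ) - x.1.2 := by exact_mod_cast hdℤ
  have hdℝ' : ((d' : ℕ) : ℝ) = (q.2.2 : ℝ) - q.1.2 := by exact_mod_cast hdℤ'
  obtain ⟨hRle, hHlo, hHhi⟩ := layerSteps_bounds hr hh x.1.2 d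
  obtain ⟨hRle', hHlo', hHhi'⟩ := layerSteps_bounds hr hh q.1.2 d'
  set c₀ : ℝ := ((refF0 ℓ x.2 - refF0 ℓ x.1 : ℤ) : ℝ) / 3 with hc₀
  set c₁ : ℝ := ((refF1 ℓ x.2 - refF1 ℓ x.1 : ℤ) : ℝ) / 3 with hc₁
  set c₀' : ℝ := ((refF0 ℓ q.2 - refF0 ℓ q.1 : ℤ) : ℝ) / 3 with hc₀'
  set c₁' : ℝ := ((refF1 ℓ q.2 - refF1 ℓ q.1 : ℤ) : ℝ) / 3 with hc₁'
  set R : E3 := ∑ k ∈ Finset.range d, r (x.1.2 + k) with hR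
  set R' : E3 := ∑ k ∈ Finset.range d', r (q.1.2 + k) with hR'
  set H : ℝ := ∑ k ∈ Finset.range d, h (x.1.2 + k) with hH
  set H' : ℝ := ∑ k ∈ Finset.range d', h (q.1.2 + k) with hH'
  -- the ideal witness `t⋆ = d18/(2 n9)` and the two decompositions
  set t : ℝ := (d18F ℓ x q : ℝ) / (2 * n9F ℓ x) with ht
  set v : E3 := c₀ • triangularVec₁ 1 + c₁ • triangularVec₂ 1 with hv
  set v' : E3 := c₀' • triangularVec₁ 1 + c₁' • triangularVec₂ 1 with hv'
  set vD : E3 := (c₀' - t * c₀) • triangularVec₁ 1 + (c₁' - t * c₁) • triangularVec₂ 1 with hvD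
  have hdec : bondVec (gen₁ L) (gen₂ L) w x = (L : E3 →L[ℝ] E3) v + R + H • n := bondVec_decomp_of_stepsF hstep x d hd
  have hdec' : bondVec (gen₁ L) (gen₂ L) w q = (L : E3 →L[ℝ] E3) v' + R' + H' • n := bondVec_decomp_of_stepsF hstep q d' hd'
  have hvD' : v' - t • v = vD := by
    simp only [hvD, hv, hv', smul_add, smul_smul, sub_smul]; abel
  have hW : bondVec (gen₁ L) (gen₂ L) w q - t • bondVec (gen₁ L) (gen₂ L) w x =
      ((L : E3 →L[ℝ] E3) vD + (R' - t • R)) + (H' - t * H) • n := by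
    rw [hdec, hdec', ← hvD']
    simp only [map_sub, map_smul, sub_smul, smul_add, smul_smul]
    abel
  -- orthogonality and Pythagoras for `e' − t•e`
  have hLvD : (L : E3 →L[ℝ] E3) vD = (c₀' - t * c₀) • gen₁ L + (c₁' - t * c₁) • gen₂ L := by simp [hvD, gen₁, gen₂]
  have hRn : ⟪R, n⟫ = 0 := by rw [hR, sum_inner]; simp [hrn]
  have hRn' : ⟪R', n⟫ = 0 := by rw [hR', sum_inner]; simp [hrn]
  have horth : ⟪(L : E3 →L[ℝ] E3) vD + (R' - t • R), n⟫ = 0 := by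
    rw [inner_add_left, hLvD, inner_add_left, real_inner_smul_left, real_inner_smul_left, hg₁, hg₂, inner_sub_left,
      real_inner_smul_left, hRn, hRn']
    ring
  have hWsq : ‖bondVec (gen₁ L) (gen₂ L) w q - t • bondVec (gen₁ L) (gen₂ L) w x‖ ^ 2 =
      ‖(L : E3 →L[ℝ] E3) vD + (R' - t • R)‖ ^ 2 + (H' - t * H) ^ 2 := by
    rw [hW]; exact normSq_add_smul_of_inner_zero _ _ _ hn horth
  -- the ideal quantities in reals
  have hX2 : ‖vD‖ ^ 2 = (c₀' - t * c₀) ^ 2 + (c₀' - t * c₀) * (c₁' - t * c₁) + (c₁' - t * c₁) ^ 2 := by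
    rw [hvD]; exact normSq_triangular_comb _ _
  have hn9 : (n9F ℓ x : ℝ) = (3 * c₀) * (3 * c₀) + (3 * c₀) * (3 * c₁) + (3 * c₁) * (3 * c₁) + 6 * (d : ℝ) ^ 2 := by
    rw [hc₀, hc₁, hdℝ]; simp only [n9F]; push_cast; ring
  have hn9' : (n9F ℓ q : ℝ) = (3 * c₀') * (3 * c₀') + (3 * c₀') * (3 * c₁') + (3 * c₁') * (3 * c₁') + 6 * (d' : ℝ) ^ 2 := by
    rw [hc₀', hc₁', hdℝ']; simp only [n9F]; push_cast; ring
  have hd18 : (d18F ℓ x q : ℝ) = 2 * (3 * c₀) * (3 * c₀') + 2 * (3 * c₁) * (3 * c₁') + (3 * c₀) * (3 * c₁') +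
      (3 * c₀') * (3 * c₁) + 12 * (d : ℝ) * (d' : ℝ) := by
    rw [hc₀, hc₁, hc₀', hc₁', hdℝ, hdℝ']; simp only [d18F]; push_cast; ring
  have hxℝ : (0 : ℝ) < n9F ℓ x := by exact_mod_cast hx
  have hqℝ : (0 : ℝ) < n9F ℓ q := by exact_mod_cast hq
  obtain ⟨hid, hP2, -⟩ := angle_ideal_facts (s0 := sinSq0F ℓ x q) (X := ‖vD‖) hxℝ hqℝ hn9 hn9' hd18 ht rfl hX2
  -- bounds on the in-plane and normal parts
  have hLvb := (norm_map_bounds_of_isConfChart ha hconf vD).2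
  have hU : ‖(L : E3 →L[ℝ] E3) vD + (R' - t • R)‖ ≤ (a + s * a) * ‖vD‖ + τ * a * ((d' : ℝ) + |t| * d) := by
    have h1 := norm_add_le ((L : E3 →L[ℝ] E3) vD) (R' - t • R)
    have h2 : ‖R' - t • R‖ ≤ ‖R'‖ + |t| * ‖R‖ := by
      have := norm_sub_le R' (t • R); rwa [norm_smul, Real.norm_eq_abs] at this
    have h3 : |t| * ‖R‖ ≤ |t| * (d * (τ * a)) := mul_le_mul_of_nonneg_left hRle (abs_nonneg t)
    have h4 : |t| * (d * (τ * a)) = τ * a * (|t| * d) := by ring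
    linarith [h1, h2, h3, h4, hRle']
  have hN : |H' - t * H| ≤ |a * ((hLo + hHi) / 2) * ((d' : ℝ) - t * d)| + a * ((hHi - hLo) / 2) * ((d' : ℝ) + |t| * d) := by
    have e1 : H' - t * H = a * ((hLo + hHi) / 2) * ((d' : ℝ) - t * d) +
        ((H' - a * ((hLo + hHi) / 2) * d') - t * (H - a * ((hLo + hHi) / 2) * d)) := by ring
    have hpin : |H - a * ((hLo + hHi) / 2) * d| ≤ a * ((hHi - hLo) / 2) * d := by
      rw [abs_le]; constructor <;> linarith [hHlo, hHhi]
    have hpin' : |H' - a * ((hLo + hHi) / 2) * d'| ≤ a * ((hHi - hLo) / 2) * d' := by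
      rw [abs_le]; constructor <;> linarith [hHlo', hHhi']
    have h2 : |(H' - a * ((hLo + hHi) / 2) * d') - t * (H - a * ((hLo + hHi) / 2) * d)| ≤
        a * ((hHi - hLo) / 2) * d' + |t| * (a * ((hHi - hLo) / 2) * d) := by
      refine (abs_sub _ _).trans ?_
      rw [abs_mul]
      exact add_le_add hpin' (mul_le_mul_of_nonneg_left hpin (abs_nonneg t))
    have h3 : a * ((hHi - hLo) / 2) * d' + |t| * (a * ((hHi - hLo) / 2) * d) =
        a * ((hHi - hLo) / 2) * ((d' : ℝ) + |t| * d) := by ring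
    rw [e1]
    refine (abs_add_le _ _).trans ?_
    linarith [h2, h3]
  -- the core and the ratio
  have hcore := angle_core (n9' := (n9F ℓ q : ℝ)) (s0 := sinSq0F ℓ x q) hβ (by positivity) (norm_nonneg _) hU hN hP2 hid hhb
    ha hΔ
  have he'0 : bondVec (gen₁ L) (gen₂ L) w q ≠ 0 := by
    intro h0
    rw [h0, norm_zero] at hlen
    have := mul_pos (pow_pos hlam 2) hqℝ
    linarith
  have hSW : sinSqPair (gen₁ L) (gen₂ L) w x q ≤ ‖bondVec (gen₁ L) (gen₂ L) w q - t • bondVec (gen₁ L) (gen₂ L) w x‖ ^ 2 /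
      ‖bondVec (gen₁ L) (gen₂ L) w q‖ ^ 2 := sinSq_le_witness _ _ he'0 t
  rw [hWsq] at hSW
  exact angle_ratio hβ hlam hqℝ (by positivity) hSW hcore (by linarith [hlen])

/-! ### §3 the angle comparison lemma -/

/-- the angle comparison is monotone in `(K, η)`. [g100] -/
theorem idealAngleCmpF_mono {ℓ : ℤ → ℤ} {K η K' η' : ℝ} {a b : E3} {w : ℤ → E3} (hK : K ≤ K') (hη : η ≤ η')
    (h : IdealAngleCmpF ℓ K η a b w) : IdealAngleCmpF ℓ K' η' a b w := by
  intro x q hx hq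
  have h0 := sinSq0F_nonneg ℓ x q hx hq
  have := h x q hx hq
  nlinarith [mul_le_mul_of_nonneg_right hK h0]

/-- ★★ THE ANGLE COMPARISON LEMMA: a word in the slab box with a length floor `λ` satisfies `IdealAngleCmpF ℓ K η (gen₁ L) (gen₂ L) w`
with `K = (1+β)((1+s)aHi/λ)²`, `η = 6(1+β⁻¹)(aHi/λ)²(τ² + (hHi−hLo)²/4)` for every dial `β > 0`, under the sign conditions and
the mild height/stretch check `3(hLo+hHi)² ≤ 8(1+s)²`. [g100] -/
theorem idealAngleCmpF_of_slabBoxF {ℓ : ℤ → ℤ} {aLo aHi s τ hLo hHi lam mu β : ℝ} {L : E3 ≃L[ℝ] E3} {w : ℤ → E3}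
    (hB : SlabBoxF ℓ aLo aHi s τ hLo hHi L w) (hlen : IdealLengthCmpF ℓ lam mu (gen₁ L) (gen₂ L) w) (haLo : 0 ≤ aLo)
    (hs0 : 0 ≤ s) (hΔ : hLo ≤ hHi) (hhb : 3 * (hLo + hHi) ^ 2 ≤ 8 * (1 + s) ^ 2) (hlam : 0 < lam) (hβ : 0 < β) :
    IdealAngleCmpF ℓ ((1 + β) * ((1 + s) * aHi / lam) ^ 2) (6 * (1 + β⁻¹) * (aHi / lam) ^ 2 * (τ ^ 2 + (hHi - hLo) ^ 2 / 4))
      (gen₁ L) (gen₂ L) w := by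
  obtain ⟨a, n, r, h, haLo', haHi', hconf, hn, hg₁, hg₂, hr, hh, hrn, hstep⟩ := hB
  have ha : 0 ≤ a := haLo.trans haLo'
  have hβ' : 0 < β⁻¹ := inv_pos.2 hβ
  -- both pairs upward
  have main : ∀ x q : (Cell 2 × ℤ) × (Cell 2 × ℤ), 0 < n9F ℓ x → 0 < n9F ℓ q → x.1.2 ≤ x.2.2 → q.1.2 ≤ q.2.2 →
      sinSqPair (gen₁ L) (gen₂ L) w x q ≤ (1 + β) * ((1 + s) * a / lam) ^ 2 * sinSq0F ℓ x q +
        6 * (1 + β⁻¹) * (a / lam) ^ 2 * (τ ^ 2 + (hHi - hLo) ^ 2 / 4) := fun x q hx hq hxle hqle =>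
    angleCmpF_pair_of_steps ha hΔ hhb hlam hβ hconf hn hg₁ hg₂ hr hh hrn hstep x q hx hq hxle hqle (hlen q).1
  -- the second pair in either orientation
  have main' : ∀ x q : (Cell 2 × ℤ) × (Cell 2 × ℤ), 0 < n9F ℓ x → 0 < n9F ℓ q → x.1.2 ≤ x.2.2 →
      sinSqPair (gen₁ L) (gen₂ L) w x q ≤ (1 + β) * ((1 + s) * a / lam) ^ 2 * sinSq0F ℓ x q +
        6 * (1 + β⁻¹) * (a / lam) ^ 2 * (τ ^ 2 + (hHi - hLo) ^ 2 / 4) := by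
    intro x q hx hq hxle
    rcases le_or_gt q.1.2 q.2.2 with hqle | hqgt
    · exact main x q hx hq hxle hqle
    · have h' := main x (q.2, q.1) hx (by rwa [n9F_swap]) hxle hqgt.le
      rwa [sinSqPair_swap_right, sinSq0F_swap_right] at h'
  intro x q hx hq
  -- the first pair in either orientation
  have hxq : sinSqPair (gen₁ L) (gen₂ L) w x q ≤ (1 + β) * ((1 + s) * a / lam) ^ 2 * sinSq0F ℓ x q +
      6 * (1 + β⁻¹) * (a / lam) ^ 2 * (τ ^ 2 + (hHi - hLo) ^ 2 / 4) := by
    rcases le_or_gt x.1.2 x.2.2 with hxle | hxgt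
    · exact main' x q hx hq hxle
    · have h' := main' (x.2, x.1) q (by rwa [n9F_swap]) hq hxgt.le
      rwa [sinSqPair_swap_left, sinSq0F_swap_left] at h'
  -- monotonicity `a ≤ aHi`
  have h0 := sinSq0F_nonneg ℓ x q hx hq
  have hmono : (1 + β) * ((1 + s) * a / lam) ^ 2 * sinSq0F ℓ x q + 6 * (1 + β⁻¹) * (a / lam) ^ 2 * (τ ^ 2 + (hHi - hLo) ^ 2 / 4) ≤
      (1 + β) * ((1 + s) * aHi / lam) ^ 2 * sinSq0F ℓ x q +
        6 * (1 + β⁻¹) * (aHi / lam) ^ 2 * (τ ^ 2 + (hHi - hLo) ^ 2 / 4) := by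
    gcongr
  exact hxq.trans hmono

/-! ### §4 the periodic word as the special case `ℓ := regW wd` -/

/-- ideal `sin² ≥ 0` for a periodic word (bridge). [g100] -/
theorem sinSq0_nonneg (wd : List ℤ) (x q : (Cell 2 × ℤ) × (Cell 2 × ℤ)) (hx : 0 < n9W wd x) (hq : 0 < n9W wd q) :
    0 ≤ sinSq0 wd x q :=
  sinSq0F_nonneg (regW wd) x q hx hq

/-- the periodic angle comparison is monotone in `(K, η)` (bridge). [g100] -/
theorem idealAngleCmp_mono {wd : List ℤ} {K η K' η' : ℝ} {a b : E3} {w : ℤ → E3} (hK : K ≤ K') (hη : η ≤ η')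
    (h : IdealAngleCmp wd K η a b w) : IdealAngleCmp wd K' η' a b w :=
  idealAngleCmpF_mono (ℓ := regW wd) hK hη h

/-- ★★ THE ANGLE COMPARISON LEMMA for a periodic word `wd` in `SlabBoxW wd …` (bridge instance of `idealAngleCmpF_of_slabBoxF`):
`IdealAngleCmp wd ((1+β)((1+s)aHi/λ)²) (6(1+β⁻¹)(aHi/λ)²(τ² + (hHi−hLo)²/4)) (gen₁ L) (gen₂ L) w`. [g100] -/
theorem idealAngleCmp_of_slabBox {wd : List ℤ} {aLo aHi s τ hLo hHi lam mu β : ℝ} {L : E3 ≃L[ℝ] E3} {w : ℤ → E3}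
    (hB : SlabBoxW wd aLo aHi s τ hLo hHi L w) (hlen : IdealLengthCmp wd lam mu (gen₁ L) (gen₂ L) w) (haLo : 0 ≤ aLo)
    (hs0 : 0 ≤ s) (hΔ : hLo ≤ hHi) (hhb : 3 * (hLo + hHi) ^ 2 ≤ 8 * (1 + s) ^ 2) (hlam : 0 < lam) (hβ : 0 < β) :
    IdealAngleCmp wd ((1 + β) * ((1 + s) * aHi / lam) ^ 2) (6 * (1 + β⁻¹) * (aHi / lam) ^ 2 * (τ ^ 2 + (hHi - hLo) ^ 2 / 4))
      (gen₁ L) (gen₂ L) w :=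
  idealAngleCmpF_of_slabBoxF (ℓ := regW wd) hB hlen haLo hs0 hΔ hhb hlam hβ

/-- DOCK (ATLAS-D-56 cell of record, word `[0,1,2]`, `β = 1`): the box of ZZZYRCZM's dock with its certified length window
`(λ, μ) = (0.77424, 0.95705)` yields `IdealAngleCmp [0,1,2] 2.63 0.0073`. [g100] -/
example {L : E3 ≃L[ℝ] E3} {w : ℤ → E3}
    (hB : SlabBoxW [0, 1, 2] (86020 / 100000) (87010 / 100000) (1 / 50) (175 / 10000) (7536 / 10000) (7798 / 10000) L w)
    (hlen : IdealLengthCmp [0, 1, 2] (77424 / 100000) (95705 / 100000) (gen₁ L) (gen₂ L) w) :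
    IdealAngleCmp [0, 1, 2] (263 / 100) (73 / 10000) (gen₁ L) (gen₂ L) w :=
  idealAngleCmp_mono (by norm_num) (by norm_num)
    (idealAngleCmp_of_slabBox (β := 1) hB hlen (by norm_num) (by norm_num) (by norm_num) (by norm_num) (by norm_num) one_pos)

end Summit.AtomisticToContinuum.Crystallization.Theorems.ChartedZeroExcessLayeredLatticeLiouville
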